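import Literature.Barriers.ABC.BakerMethodBoundsYuInput
import Literature.Barriers.ABC.BakerMethodBoundsWeakArchProofs
import Literature.NumberTheory.DiophantineGeometry.MultiplicativeGroupApproximationThm328Proofs
import Literature.NumberTheory.DiophantineGeometry.PastenSubexpGenerators
import HarnessLib

/-!
# The rung-A1.M3 crux texts `Y07Odd` / `Y07Two` are CONSEQUENCES of the tree's named facts of record
# (Pasten's `p`-adic clause (ii) over `ℚ`, hence Yu 2007 over `ℚ`) — T1/BC2 dossier of the staged
# route `PadicPrimesKummerThird` (cell `abc-stewartyu`, lit seat g5, 2026-08-26)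

The staged rung route `PadicPrimesKummerThird` (HOME/plan/routes/RouteM3K.md; closes_target
`Literature.NumberTheory.DiophantineGeometry.stewart_yu`, exponent `1/3`) has two cruxes, the
Yu-2007-quality `p`-adic texts for rational PRIMES (`K^{#S}`, `p/(log p)²` in `ord_p` units, ONE
logarithm):

`Y07Odd`: `∃ c₆, ∀ p prime, p ≠ 2, ∀ S ⊂ primes, p ∉ S, S ≠ ∅, ∀ e B, 3 ≤ B, |e_q| ≤ B,
  ∏_{q∈S} q^{e_q} ≠ 1 → ord_p(∏ q^{e_q} − 1)·log p < c₆^{#S}·(p/log p)·(log p + log B + log log max(4, max S))·∏_{q∈S} log q`,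
`Y07Two`: the same at `p = 2` (`2 ∉ S`).

This file proves, with the crux texts VERBATIM as conclusions (the route is not born yet, so the
`Theses` module with the `def`s does not exist; compare `YuNinetyW80TwoTransfer.lean`):

* `padicClause_of_yu2007` — Pasten's clause (ii) over `ℚ` with `K = pastenK` (the binder `hP2` of
  `BakerMethodBounds_of_padicClause_kummerArchBound₂`, i.e. the planner's typed target T_P) from the
  named fact `yu2007_padicLogForm_rat` (T_Y): the composition of the tree theorems
  `Dioph.thm328_rat_finite_of_yu` (Evertse–Győry p. 63) and `padicClause_of_thm328_finite`;
* `y07_of_padicClause` — the MASTER inequality at EVERY prime `p` and every non-empty set of primes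
  `S` (no parity, no `p ∉ S` needed) from the clause with constant `K ≥ 1`: `c₆ = 2K`
  (instantiate `ι = S`, `ξ_q = q`, `ζ = 1`; `h(q) = log q`; `h(∏ q^{e_q}) ≤ B·#S·log A`, so
  `log max(e, p·h) ≤ log p + log B + log #S + log log A ≤ 2^{#S}(log p + log B + log log A)`);
* `y07Odd_of_padicClause`, `y07Two_of_padicClause`, `y07Odd_of_yu2007`, `y07Two_of_yu2007` — the
  crux texts verbatim.

So C (each crux) ⇐ T_P ⇐ T_Y = H: the cruxes are honest WEAKENINGS of the named fact of record (the
route's content is proving them WITHOUT H, by the cell's own engine), and their texts are thereby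
cross-checked against Yu's theorem as vendored. WHAT THIS IS NOT: no `p`-adic estimate is proved here;
nothing is asserted (theorems from binders / named facts only); no crux is closed.

## References
* [EvertseGyory2015] J.-H. Evertse, K. Győry, *Unit Equations in Diophantine Number Theory*, CUP 2015,
  Thm. 3.2.7–3.2.8 (pp. 62–63).
* [Pasten2024] H. Pasten, *The largest prime factor of `n² + 1` and improvements on subexponential
  ABC*, Invent. Math. 236 (2024), Theorem 2.1 (ii).
* [Yu2007] K. Yu, *p-adic logarithmic forms and group varieties III*, Forum Math. 19 (2007) 187–280.
-/

noncomputable section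

open Finset Real Height
open Literature.NumberTheory.DiophantineGeometry
open Literature.NumberTheory.DiophantineGeometry.Dioph
open Literature.NumberTheory.DiophantineGeometry.Pasten
open Literature.Barriers.ABC

namespace Summit.ABC.StewartYu.Y07

/-- **T_Y ⇒ T_P**: Pasten's `p`-adic clause (ii) over `ℚ` (constant `pastenK`) from Yu's theorem over
`ℚ` as vendored (`yu2007_padicLogForm_rat`), by the tree's `thm328_rat_finite_of_yu` and
`padicClause_of_thm328_finite`. [cite: EvertseGyory2015, Thm 3.2.8 (p. 63)] [cite: Pasten2024, Thm 2.1 (ii)] -/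
theorem padicClause_of_yu2007 (h : yu2007_padicLogForm_rat) :
    ∀ (ι : Type) [Fintype ι], 0 < Fintype.card ι →
      ∀ ξ : ι → ℚ, (∀ i, ξ i ≠ 0 ∧ ξ i ≠ 1 ∧ ξ i ≠ -1) →
      ∀ ζ : ℚ, (ζ = 1 ∨ ζ = -1) → ∀ b : ι → ℤ, ζ * ∏ i, ξ i ^ b i ≠ 1 →
      ∀ p : ℕ, p.Prime →
        (padicValRat p (1 - ζ * ∏ i, ξ i ^ b i) : ℝ) * Real.log p <
          pastenK ^ Fintype.card ι * (p / Real.log p) *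
            Real.log (max (Real.exp 1) (p * logHeight₁ (ζ * ∏ i, ξ i ^ b i))) *
            ∏ i, logHeight₁ (ξ i) :=
  padicClause_of_thm328_finite (thm328_rat_finite_of_yu h)

/-- `1 + n ≤ 2^n`. [folklore] -/
private theorem one_add_le_two_pow (n : ℕ) : (1 : ℝ) + n ≤ 2 ^ n := by
  have h : 1 + n ≤ 2 ^ n := by
    induction n with
    | zero => simp
    | succ k ih =>
      calc 1 + (k + 1) ≤ 2 ^ k + 2 ^ k := by omega
        _ = 2 ^ (k + 1) := by ring
  exact_mod_cast h

/-- **The master inequality** (every prime `p`, every non-empty finite set of primes `S`): Pasten's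
clause with constant `K ≥ 1` gives the crux shape with `c₆ = 2K`. Bookkeeping: `ι = S`, `ξ_q = q`
(`≠ 0, ±1`), `ζ = 1`, `h(q) = log q`, `h(∏ q^{e_q}) ≤ ∑ |e_q| log q ≤ #S·B·log A` (`A = max(4, max S)`),
`log max(e, p·h) ≤ log p + log B + log #S + log log A ≤ 2^{#S}·(log p + log B + log log A)`
(`log B ≥ 1`, `1 + #S ≤ 2^{#S}`). [folklore] -/
theorem y07_of_padicClause {K : ℝ} (hK : 1 ≤ K)
    (hP2 : ∀ (ι : Type) [Fintype ι], 0 < Fintype.card ι →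
      ∀ ξ : ι → ℚ, (∀ i, ξ i ≠ 0 ∧ ξ i ≠ 1 ∧ ξ i ≠ -1) →
      ∀ ζ : ℚ, (ζ = 1 ∨ ζ = -1) → ∀ b : ι → ℤ, ζ * ∏ i, ξ i ^ b i ≠ 1 →
      ∀ p : ℕ, p.Prime →
        (padicValRat p (1 - ζ * ∏ i, ξ i ^ b i) : ℝ) * Real.log p <
          K ^ Fintype.card ι * (p / Real.log p) *
            Real.log (max (Real.exp 1) (p * logHeight₁ (ζ * ∏ i, ξ i ^ b i))) *
            ∏ i, logHeight₁ (ξ i)) :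
    ∀ (p : ℕ), p.Prime → ∀ (S : Finset ℕ), (∀ q ∈ S, q.Prime) → S.Nonempty →
    ∀ (e : ℕ → ℤ) (B : ℝ), 3 ≤ B → (∀ q ∈ S, (|e q| : ℝ) ≤ B) →
    ∏ q ∈ S, (q : ℚ) ^ e q ≠ 1 →
    (padicValRat p (∏ q ∈ S, (q : ℚ) ^ e q - 1) : ℝ) * Real.log p <
      (2 * K) ^ S.card * ((p : ℝ) / Real.log p) *
        (Real.log p + Real.log B + Real.log (Real.log ((max 4 (S.sup id) : ℕ) : ℝ))) *
        ∏ q ∈ S, Real.log (q : ℝ) := by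
  intro p hp S hS hne e B hB heB hne1
  classical
  -- the instantiation `ι = S`, `ξ_q = q`, `ζ = 1`, `b_q = e_q`
  have hcard : Fintype.card ↥S = S.card := Fintype.card_coe S
  have hcard_pos : 0 < Fintype.card ↥S := by rw [hcard]; exact hne.card_pos
  set ξ : ↥S → ℚ := fun q => ((q.1 : ℕ) : ℚ) with hξdef
  set b : ↥S → ℤ := fun q => e q.1 with hbdef
  have hξ : ∀ i, ξ i ≠ 0 ∧ ξ i ≠ 1 ∧ ξ i ≠ -1 := fun i => natCast_prime_nonTorsion (hS i.1 i.2)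
  set X : ℚ := ∏ q ∈ S, (q : ℚ) ^ e q with hXdef
  have hprod : ∏ i, ξ i ^ b i = X := by
    rw [hXdef, ← Finset.prod_coe_sort S (fun q : ℕ => (q : ℚ) ^ e q)]
  have hne1' : (1 : ℚ) * ∏ i, ξ i ^ b i ≠ 1 := by rwa [one_mul, hprod]
  have h := hP2 (↥S) hcard_pos ξ hξ 1 (Or.inl rfl) b hne1' p hp
  rw [one_mul, hprod, hcard] at h
  -- `ord_p(1 − X) = ord_p(X − 1)`
  have hv : padicValRat p (1 - X) = padicValRat p (X - 1) := by
    rw [← padicValRat.neg, neg_sub]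
  rw [hv] at h
  -- heights of the generators: `∏ h(q) = ∏ log q`
  have hH : ∏ i, logHeight₁ (ξ i) = ∏ q ∈ S, Real.log (q : ℝ) := by
    rw [← Finset.prod_coe_sort S (fun q : ℕ => Real.log (q : ℝ))]
    refine Finset.prod_congr rfl fun i _ => ?_
    exact logHeight₁_natCast_prime (hS i.1 i.2)
  rw [hH] at h
  -- positivity bookkeeping
  have hp2 : (2 : ℝ) ≤ p := by exact_mod_cast hp.two_le
  have hp0 : (0 : ℝ) < p := by linarith
  have hlogp : 0 < Real.log p := Real.log_pos (by linarith)
  have hlogB : 1 ≤ Real.log B := by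
    rw [← Real.log_exp 1]
    exact Real.log_le_log (Real.exp_pos 1) (by have := Real.exp_one_lt_d9; linarith)
  set A : ℝ := ((max 4 (S.sup id) : ℕ) : ℝ) with hAdef
  have hA4 : (4 : ℝ) ≤ A := by rw [hAdef]; exact_mod_cast le_max_left _ _
  have hlogA : 1 < Real.log A := by
    rw [← Real.log_exp 1]
    exact Real.log_lt_log (Real.exp_pos 1) (by have := Real.exp_one_lt_d9; linarith)
  have hloglogA : 0 < Real.log (Real.log A) := Real.log_pos hlogA
  have hqA : ∀ q ∈ S, (q : ℝ) ≤ A := by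
    intro q hq
    rw [hAdef]
    have h1 : q ≤ S.sup id := Finset.le_sup (f := id) hq
    exact_mod_cast h1.trans (le_max_right 4 _)
  have hq2 : ∀ q ∈ S, (2 : ℝ) ≤ q := fun q hq => by exact_mod_cast (hS q hq).two_le
  have hlogq : ∀ q ∈ S, 0 < Real.log (q : ℝ) := fun q hq => Real.log_pos (by linarith [hq2 q hq])
  have hP : 0 < ∏ q ∈ S, Real.log (q : ℝ) := Finset.prod_pos hlogq
  set L : ℝ := Real.log p + Real.log B + Real.log (Real.log A) with hLdef
  have hL1 : 1 ≤ L := by rw [hLdef]; linarith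
  set n : ℕ := S.card with hndef
  have hn1 : 1 ≤ n := hne.card_pos
  -- the height of the value: `h(X) ≤ #S · B · log A`
  have hX : logHeight₁ X ≤ n * (B * Real.log A) := by
    calc logHeight₁ X ≤ ∑ q ∈ S, logHeight₁ ((q : ℚ) ^ e q) := logHeight₁_prod_le _ _
      _ ≤ ∑ q ∈ S, B * Real.log A := by
          refine Finset.sum_le_sum fun q hq => ?_
          rw [logHeight₁_zpow, logHeight₁_natCast_prime (hS q hq)]
          have h1 : (((e q).natAbs : ℕ) : ℝ) = |(e q : ℝ)| := by
            rw [Nat.cast_natAbs, Int.cast_abs]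
          rw [h1]
          have hlq : Real.log (q : ℝ) ≤ Real.log A :=
            Real.log_le_log (by linarith [hq2 q hq]) (hqA q hq)
          exact mul_le_mul (heB q hq) hlq (hlogq q hq).le (by linarith)
      _ = n * (B * Real.log A) := by rw [Finset.sum_const, nsmul_eq_mul]
  -- `log max(e, p·h(X)) ≤ 2^n · L`
  have hLM : Real.log (max (Real.exp 1) (p * logHeight₁ X)) ≤ 2 ^ n * L := by
    have h2n : (1 : ℝ) + n ≤ 2 ^ n := one_add_le_two_pow n
    have hL2 : L ≤ 2 ^ n * L := by nlinarith
    rcases le_or_gt ((p : ℝ) * logHeight₁ X) (Real.exp 1) with hle | hlt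
    · rw [max_eq_left hle, Real.log_exp]
      linarith
    · rw [max_eq_right hlt.le]
      have hY0 : 0 < (p : ℝ) * (n * (B * Real.log A)) := by
        have : (0 : ℝ) < n := by exact_mod_cast hn1
        have : (0 : ℝ) < B := by linarith
        positivity
      have hpos : 0 < (p : ℝ) * logHeight₁ X := (Real.exp_pos 1).trans hlt
      calc Real.log ((p : ℝ) * logHeight₁ X)
          ≤ Real.log ((p : ℝ) * (n * (B * Real.log A))) :=
            Real.log_le_log hpos (mul_le_mul_of_nonneg_left hX hp0.le)
        _ = Real.log p + Real.log n + Real.log B + Real.log (Real.log A) := by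
            have hn0 : (n : ℝ) ≠ 0 := by exact_mod_cast (Nat.one_le_iff_ne_zero.mp hn1)
            have hB0 : (B : ℝ) ≠ 0 := by linarith
            rw [Real.log_mul hp0.ne' (by positivity), Real.log_mul hn0 (by positivity),
              Real.log_mul hB0 (by linarith)]
            ring
        _ ≤ L + n := by
            have hlogn : Real.log n ≤ n := by
              have := Real.log_le_sub_one_of_pos (show (0 : ℝ) < n by exact_mod_cast hn1)
              linarith
            rw [hLdef]; linarith
        _ ≤ 2 ^ n * L := by nlinarith
  -- assemble
  have hRHS : K ^ n * ((p : ℝ) / Real.log p) * Real.log (max (Real.exp 1) (p * logHeight₁ X)) *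
      ∏ q ∈ S, Real.log (q : ℝ) ≤
      (2 * K) ^ n * ((p : ℝ) / Real.log p) * L * ∏ q ∈ S, Real.log (q : ℝ) := by
    have hKn : 0 ≤ K ^ n := pow_nonneg (by linarith) n
    have hfac : 0 ≤ K ^ n * ((p : ℝ) / Real.log p) * ∏ q ∈ S, Real.log (q : ℝ) := by positivity
    calc K ^ n * ((p : ℝ) / Real.log p) * Real.log (max (Real.exp 1) (p * logHeight₁ X)) *
          ∏ q ∈ S, Real.log (q : ℝ)
        = (K ^ n * ((p : ℝ) / Real.log p) * ∏ q ∈ S, Real.log (q : ℝ)) *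
            Real.log (max (Real.exp 1) (p * logHeight₁ X)) := by ring
      _ ≤ (K ^ n * ((p : ℝ) / Real.log p) * ∏ q ∈ S, Real.log (q : ℝ)) * (2 ^ n * L) :=
          mul_le_mul_of_nonneg_left hLM hfac
      _ = (2 * K) ^ n * ((p : ℝ) / Real.log p) * L * ∏ q ∈ S, Real.log (q : ℝ) := by
          rw [mul_pow]; ring
  exact lt_of_lt_of_le h hRHS

/-- **Crux text `Y07Odd` (rank 2 of route `PadicPrimesKummerThird`) from Pasten's clause** (verbatim
statement; `c₆ = 2K`). [folklore] -/
theorem y07Odd_of_padicClause {K : ℝ} (hK : 1 ≤ K)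
    (hP2 : ∀ (ι : Type) [Fintype ι], 0 < Fintype.card ι →
      ∀ ξ : ι → ℚ, (∀ i, ξ i ≠ 0 ∧ ξ i ≠ 1 ∧ ξ i ≠ -1) →
      ∀ ζ : ℚ, (ζ = 1 ∨ ζ = -1) → ∀ b : ι → ℤ, ζ * ∏ i, ξ i ^ b i ≠ 1 →
      ∀ p : ℕ, p.Prime →
        (padicValRat p (1 - ζ * ∏ i, ξ i ^ b i) : ℝ) * Real.log p <
          K ^ Fintype.card ι * (p / Real.log p) *
            Real.log (max (Real.exp 1) (p * logHeight₁ (ζ * ∏ i, ξ i ^ b i))) *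
            ∏ i, logHeight₁ (ξ i)) :
    ∃ c₆ : ℝ, ∀ (p : ℕ), p.Prime → p ≠ 2 → ∀ (S : Finset ℕ), (∀ q ∈ S, q.Prime) → p ∉ S →
      S.Nonempty → ∀ (e : ℕ → ℤ) (B : ℝ), 3 ≤ B → (∀ q ∈ S, (|e q| : ℝ) ≤ B) →
      ∏ q ∈ S, (q : ℚ) ^ e q ≠ 1 →
      (padicValRat p (∏ q ∈ S, (q : ℚ) ^ e q - 1) : ℝ) * Real.log p <
        c₆ ^ S.card * ((p : ℝ) / Real.log p) *
          (Real.log p + Real.log B + Real.log (Real.log ((max 4 (S.sup id) : ℕ) : ℝ))) *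
          ∏ q ∈ S, Real.log (q : ℝ) :=
  ⟨2 * K, fun p hp _ S hS _ hne e B hB heB hne1 =>
    y07_of_padicClause hK hP2 p hp S hS hne e B hB heB hne1⟩

/-- **Crux text `Y07Two` (rank 3) from Pasten's clause** (verbatim statement; `c₆ = 2K`). [folklore] -/
theorem y07Two_of_padicClause {K : ℝ} (hK : 1 ≤ K)
    (hP2 : ∀ (ι : Type) [Fintype ι], 0 < Fintype.card ι →
      ∀ ξ : ι → ℚ, (∀ i, ξ i ≠ 0 ∧ ξ i ≠ 1 ∧ ξ i ≠ -1) →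
      ∀ ζ : ℚ, (ζ = 1 ∨ ζ = -1) → ∀ b : ι → ℤ, ζ * ∏ i, ξ i ^ b i ≠ 1 →
      ∀ p : ℕ, p.Prime →
        (padicValRat p (1 - ζ * ∏ i, ξ i ^ b i) : ℝ) * Real.log p <
          K ^ Fintype.card ι * (p / Real.log p) *
            Real.log (max (Real.exp 1) (p * logHeight₁ (ζ * ∏ i, ξ i ^ b i))) *
            ∏ i, logHeight₁ (ξ i)) :
    ∃ c₆ : ℝ, ∀ (S : Finset ℕ), (∀ q ∈ S, q.Prime) → 2 ∉ S → S.Nonempty →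
      ∀ (e : ℕ → ℤ) (B : ℝ), 3 ≤ B → (∀ q ∈ S, (|e q| : ℝ) ≤ B) →
      ∏ q ∈ S, (q : ℚ) ^ e q ≠ 1 →
      (padicValRat 2 (∏ q ∈ S, (q : ℚ) ^ e q - 1) : ℝ) * Real.log 2 <
        c₆ ^ S.card * ((2 : ℝ) / Real.log 2) *
          (Real.log 2 + Real.log B + Real.log (Real.log ((max 4 (S.sup id) : ℕ) : ℝ))) *
          ∏ q ∈ S, Real.log (q : ℝ) := by
  refine ⟨2 * K, fun S hS _ hne e B hB heB hne1 => ?_⟩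
  have h := y07_of_padicClause hK hP2 2 Nat.prime_two S hS hne e B hB heB hne1
  exact_mod_cast h

/-- **`Y07Odd` from Yu's theorem over `ℚ`** (`yu2007_padicLogForm_rat`; `c₆ = 2·pastenK`).
[cite: EvertseGyory2015, Thm 3.2.7 (p. 62)] -/
theorem y07Odd_of_yu2007 (h : yu2007_padicLogForm_rat) :
    ∃ c₆ : ℝ, ∀ (p : ℕ), p.Prime → p ≠ 2 → ∀ (S : Finset ℕ), (∀ q ∈ S, q.Prime) → p ∉ S →
      S.Nonempty → ∀ (e : ℕ → ℤ) (B : ℝ), 3 ≤ B → (∀ q ∈ S, (|e q| : ℝ) ≤ B) →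
      ∏ q ∈ S, (q : ℚ) ^ e q ≠ 1 →
      (padicValRat p (∏ q ∈ S, (q : ℚ) ^ e q - 1) : ℝ) * Real.log p <
        c₆ ^ S.card * ((p : ℝ) / Real.log p) *
          (Real.log p + Real.log B + Real.log (Real.log ((max 4 (S.sup id) : ℕ) : ℝ))) *
          ∏ q ∈ S, Real.log (q : ℝ) :=
  y07Odd_of_padicClause one_le_pastenK (padicClause_of_yu2007 h)

/-- **`Y07Two` from Yu's theorem over `ℚ`** (`c₆ = 2·pastenK`). [cite: EvertseGyory2015, Thm 3.2.7 (p. 62)] -/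
theorem y07Two_of_yu2007 (h : yu2007_padicLogForm_rat) :
    ∃ c₆ : ℝ, ∀ (S : Finset ℕ), (∀ q ∈ S, q.Prime) → 2 ∉ S → S.Nonempty →
      ∀ (e : ℕ → ℤ) (B : ℝ), 3 ≤ B → (∀ q ∈ S, (|e q| : ℝ) ≤ B) →
      ∏ q ∈ S, (q : ℚ) ^ e q ≠ 1 →
      (padicValRat 2 (∏ q ∈ S, (q : ℚ) ^ e q - 1) : ℝ) * Real.log 2 <
        c₆ ^ S.card * ((2 : ℝ) / Real.log 2) *
          (Real.log 2 + Real.log B + Real.log (Real.log ((max 4 (S.sup id) : ℕ) : ℝ))) *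
          ∏ q ∈ S, Real.log (q : ℝ) :=
  y07Two_of_padicClause one_le_pastenK (padicClause_of_yu2007 h)

end Summit.ABC.StewartYu.Y07

end
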